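import Mathlib.Analysis.Normed.Ring.InfiniteSum
import Mathlib.Topology.Algebra.InfiniteSum.Real
import Literature.Analysis.Toeplitz.InfiniteMatrix
import HarnessLib

/-!
# Dominated infinite matrices: the Wiener–corner algebra

Topic `Analysis/Toeplitz`, namespace `Literature.Analysis.Toeplitz`. The algebra in which the
Basor–Helton/Widom manipulations of the strong Szegő limit theorem take place
(`StrongSzegoGeometric.lean`): infinite matrices `A : ℕ × ℕ → ℂ` dominated by a **Toeplitz
majorant plus a corner majorant**,

  `‖A i j‖ ≤ a (i - j) + C σ^{i+j}`,   `a ≥ 0`,  `∑_k a k σ^{-|k|} < ∞`,  `0 < σ < 1`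

(`IsDom σ a C A`). Toeplitz matrices with symbol in the weighted Wiener algebra
`W_σ = {c : ℤ → ℂ | ∑ |c_k| σ^{-|k|} < ∞}` (in particular with geometrically decaying symbols of rate
`< σ`) have `C = 0`; Hankel products and all the "trace class" kernels of the theory have `a = 0`
(`IsCorner`). The class is closed under sums and products — the Toeplitz majorants multiply by the
convolution `rconv a b` on `ℤ`, which stays in the weighted `ℓ¹` because the weight `σ^{-|k|}` is
submultiplicative — all products are absolutely convergent, and the product is associative
(`imul_assoc`, Fubini). Packaged as the subtype `DomMat σ` this is a ring (`instance : Ring`), in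
which the triangular Toeplitz matrices of the Wiener–Hopf factors become honest units and the
commutator identities of the Szegő proof are identities in a group of units.

## Contents (all proved)

* `gw σ k = σ^{-|k|}` and its submultiplicativity; `IsWSeq σ a` (nonnegative, weighted-summable),
  `wnorm σ a = ∑ a k σ^{-|k|}`, the convolution `rconv a b` with `IsWSeq.rconv` and
  `wnorm_rconv_le : ‖a ⋆ b‖ ≤ ‖a‖ ‖b‖`;
* `IsDom σ a C A`; closure under `add/neg/sub/smul/imul`; `IsDom.isRowDom`, `IsDom.isColDom`
  (so Sylvester's identity of `KochDeterminant` applies); `imul_assoc`; distributivity;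
* `DomMat σ` (`[Fact (0 < σ)] [Fact (σ < 1)]`) with `instance : Ring (DomMat σ)`.

## References

* A. Böttcher, B. Silbermann, *Introduction to Large Truncated Toeplitz Matrices* (Springer 1999),
  §1.2–1.5 (Wiener algebras, Toeplitz and Hankel operators) — for orientation only; everything here
  is elementary.
-/

noncomputable section

open Finset Filter
open scoped _root_.Topology BigOperators

namespace Literature.Analysis.Toeplitz

/-! ### The geometric weight and weighted sequences on `ℤ` -/

/-- The geometric weight `σ^{-|k|}` on `ℤ`. [folklore] -/
def gw (σ : ℝ) (k : ℤ) : ℝ := σ⁻¹ ^ k.natAbs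

/-- The weight is positive for `σ > 0`. [folklore] -/
theorem gw_pos {σ : ℝ} (hσ : 0 < σ) (k : ℤ) : 0 < gw σ k := pow_pos (inv_pos.2 hσ) _

/-- The weight is nonnegative for `σ ≥ 0`. [folklore] -/
theorem gw_nonneg {σ : ℝ} (hσ : 0 ≤ σ) (k : ℤ) : 0 ≤ gw σ k := pow_nonneg (inv_nonneg.2 hσ) _

/-- The weight is at least `1` for `0 < σ ≤ 1`. [folklore] -/
theorem one_le_gw {σ : ℝ} (hσ : 0 < σ) (hσ1 : σ ≤ 1) (k : ℤ) : 1 ≤ gw σ k :=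
  one_le_pow₀ (one_le_inv_iff₀.2 ⟨hσ, hσ1⟩)

/-- `gw σ 0 = 1`. [folklore] -/
@[simp] theorem gw_zero (σ : ℝ) : gw σ 0 = 1 := by simp [gw]

/-- The weight is even. [folklore] -/
theorem gw_neg (σ : ℝ) (k : ℤ) : gw σ (-k) = gw σ k := by simp [gw]

/-- **Submultiplicativity** `σ^{-|k+l|} ≤ σ^{-|k|} σ^{-|l|}` (`0 < σ ≤ 1`). [folklore] -/
theorem gw_add_le {σ : ℝ} (hσ : 0 < σ) (hσ1 : σ ≤ 1) (k l : ℤ) : gw σ (k + l) ≤ gw σ k * gw σ l := by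
  rw [gw, gw, gw, ← pow_add]
  exact pow_le_pow_right₀ (one_le_inv_iff₀.2 ⟨hσ, hσ1⟩) (Int.natAbs_add_le k l)

/-- For naturals `m, i`: `σ^m ≤ σ^i σ^{-|i - m|}` (equality if `m ≤ i`). This is why Toeplitz
majorants act on corner kernels. [folklore] -/
theorem pow_le_pow_mul_gw {σ : ℝ} (hσ : 0 < σ) (hσ1 : σ ≤ 1) (m i : ℕ) :
    σ ^ m ≤ σ ^ i * gw σ ((i : ℤ) - m) := by
  rcases le_or_gt m i with h | h
  · have hnat : ((i : ℤ) - m).natAbs = i - m := by omega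
    rw [gw, hnat, inv_pow, ← div_eq_mul_inv, le_div_iff₀ (pow_pos hσ _), ← pow_add,
      Nat.add_sub_of_le h]
  · have hnat : ((i : ℤ) - m).natAbs = m - i := by omega
    rw [gw, hnat]
    calc σ ^ m ≤ σ ^ i := pow_le_pow_of_le_one hσ.le hσ1 h.le
      _ = σ ^ i * 1 := (mul_one _).symm
      _ ≤ σ ^ i * σ⁻¹ ^ (m - i) := mul_le_mul_of_nonneg_left
          (one_le_pow₀ (one_le_inv_iff₀.2 ⟨hσ, hσ1⟩)) (pow_nonneg hσ.le _)

/-- **Weighted sequences**: nonnegative `a : ℤ → ℝ` with `∑ a k σ^{-|k|} < ∞` — the majorants of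
symbols in the weighted Wiener algebra. [folklore] -/
structure IsWSeq (σ : ℝ) (a : ℤ → ℝ) : Prop where
  nonneg : ∀ k, 0 ≤ a k
  summable : Summable fun k => a k * gw σ k

/-- The weighted norm `∑ a k σ^{-|k|}`. [folklore] -/
def wnorm (σ : ℝ) (a : ℤ → ℝ) : ℝ := ∑' k, a k * gw σ k

/-- The weighted norm of a weighted sequence is nonnegative. [folklore] -/
theorem wnorm_nonneg {σ : ℝ} {a : ℤ → ℝ} (ha : IsWSeq σ a) (hσ : 0 ≤ σ) : 0 ≤ wnorm σ a :=
  tsum_nonneg fun k => mul_nonneg (ha.nonneg k) (gw_nonneg hσ k)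

/-- A weighted sequence is summable (the weight is `≥ 1`). [folklore] -/
theorem IsWSeq.summable' {σ : ℝ} {a : ℤ → ℝ} (ha : IsWSeq σ a) (hσ : 0 < σ) (hσ1 : σ ≤ 1) :
    Summable a :=
  Summable.of_nonneg_of_le ha.nonneg (fun k => le_mul_of_one_le_right (ha.nonneg k)
    (one_le_gw hσ hσ1 k)) ha.summable

/-- A weighted sequence is bounded by its weighted norm, with the weight: `a k ≤ ‖a‖ σ^{|k|}`,
in the form `a k * gw σ k ≤ wnorm σ a`. [folklore] -/
theorem IsWSeq.mul_gw_le_wnorm {σ : ℝ} {a : ℤ → ℝ} (ha : IsWSeq σ a) (hσ : 0 ≤ σ) (k : ℤ) :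
    a k * gw σ k ≤ wnorm σ a :=
  ha.summable.le_tsum k fun j _ => mul_nonneg (ha.nonneg j) (gw_nonneg hσ j)

/-- The zero sequence. [folklore] -/
theorem IsWSeq.zero (σ : ℝ) : IsWSeq σ 0 := ⟨fun _ => le_rfl, by simp⟩

/-- `wnorm σ 0 = 0`. [folklore] -/
@[simp] theorem wnorm_zero (σ : ℝ) : wnorm σ 0 = 0 := by simp [wnorm]

/-- Sums of weighted sequences. [folklore] -/
theorem IsWSeq.add {σ : ℝ} {a b : ℤ → ℝ} (ha : IsWSeq σ a) (hb : IsWSeq σ b) : IsWSeq σ (a + b) :=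
  ⟨fun k => add_nonneg (ha.nonneg k) (hb.nonneg k), by
    simpa [add_mul] using ha.summable.add hb.summable⟩

/-- The weighted norm is additive. [folklore] -/
theorem wnorm_add {σ : ℝ} {a b : ℤ → ℝ} (ha : IsWSeq σ a) (hb : IsWSeq σ b) :
    wnorm σ (a + b) = wnorm σ a + wnorm σ b := by
  simp only [wnorm, Pi.add_apply, add_mul]
  exact ha.summable.tsum_add hb.summable

/-- Nonnegative multiples of weighted sequences. [folklore] -/
theorem IsWSeq.smul {σ : ℝ} {a : ℤ → ℝ} (ha : IsWSeq σ a) {t : ℝ} (ht : 0 ≤ t) :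
    IsWSeq σ (t • a) :=
  ⟨fun k => mul_nonneg ht (ha.nonneg k), by
    simpa [mul_assoc] using ha.summable.mul_left t⟩

/-- The weighted norm is homogeneous. [folklore] -/
theorem wnorm_smul {σ : ℝ} (a : ℤ → ℝ) (t : ℝ) : wnorm σ (t • a) = t * wnorm σ a := by
  simp only [wnorm, Pi.smul_apply, smul_eq_mul, mul_assoc]
  exact tsum_mul_left

/-- Domination of weighted sequences. [folklore] -/
theorem IsWSeq.of_le {σ : ℝ} {a b : ℤ → ℝ} (hb : IsWSeq σ b) (hσ : 0 ≤ σ) (h0 : ∀ k, 0 ≤ a k)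
    (hle : ∀ k, a k ≤ b k) : IsWSeq σ a :=
  ⟨h0, Summable.of_nonneg_of_le (fun k => mul_nonneg (h0 k) (gw_nonneg hσ k))
    (fun k => mul_le_mul_of_nonneg_right (hle k) (gw_nonneg hσ k)) hb.summable⟩

/-- Monotonicity of the weighted norm. [folklore] -/
theorem wnorm_mono {σ : ℝ} {a b : ℤ → ℝ} (hb : IsWSeq σ b) (hσ : 0 ≤ σ) (h0 : ∀ k, 0 ≤ a k)
    (hle : ∀ k, a k ≤ b k) : wnorm σ a ≤ wnorm σ b :=
  (hb.of_le hσ h0 hle).summable.tsum_le_tsum (fun k => mul_le_mul_of_nonneg_right (hle k)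
    (gw_nonneg hσ k)) hb.summable

/-- **Geometric sequences are weighted sequences of every larger rate**: `D r^{|k|}` with
`0 ≤ r < σ` is in `W_σ`. [folklore] -/
theorem isWSeq_geometric {σ r D : ℝ} (hσ : 0 < σ) (hr : 0 ≤ r) (hrσ : r < σ) (hD : 0 ≤ D) :
    IsWSeq σ (fun k => D * r ^ k.natAbs) := by
  refine ⟨fun k => mul_nonneg hD (pow_nonneg hr _), ?_⟩
  have hq : r * σ⁻¹ < 1 := by rwa [← div_eq_mul_inv, div_lt_one hσ]
  have hq0 : 0 ≤ r * σ⁻¹ := mul_nonneg hr (inv_nonneg.2 hσ.le)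
  have hnat : Summable fun n : ℕ => D * (r * σ⁻¹) ^ n :=
    (summable_geometric_of_lt_one hq0 hq).mul_left D
  have heq : (fun k : ℤ => D * r ^ k.natAbs * gw σ k) = fun k => D * (r * σ⁻¹) ^ k.natAbs := by
    funext k; rw [gw, mul_pow]; ring
  rw [heq]
  refine summable_int_iff_summable_nat_and_neg.2 ⟨?_, ?_⟩
  · simpa using hnat
  · simpa using hnat

/-! ### Convolution of majorants on `ℤ` -/

/-- The convolution `(a ⋆ b) k = ∑_l a l * b (k - l)` of two real sequences on `ℤ`. [folklore] -/
def rconv (a b : ℤ → ℝ) (k : ℤ) : ℝ := ∑' l, a l * b (k - l)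

/-- The weighted product family `(a l σ^{-|l|})(b m σ^{-|m|})` is summable on `ℤ × ℤ`. [folklore] -/
theorem IsWSeq.summable_prod {σ : ℝ} {a b : ℤ → ℝ} (ha : IsWSeq σ a) (hb : IsWSeq σ b) (hσ : 0 ≤ σ) :
    Summable fun p : ℤ × ℤ => (a p.1 * gw σ p.1) * (b p.2 * gw σ p.2) := by
  refine summable_mul_of_summable_norm (f := fun l => a l * gw σ l) (g := fun m => b m * gw σ m) ?_ ?_
  · exact ha.summable.congr fun l => (Real.norm_of_nonneg (mul_nonneg (ha.nonneg l) (gw_nonneg hσ l))).symm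
  · exact hb.summable.congr fun m => (Real.norm_of_nonneg (mul_nonneg (hb.nonneg m) (gw_nonneg hσ m))).symm

/-- The shear `(k, l) ↦ (l, k - l)` of `ℤ × ℤ`. [folklore] -/
def shearEquiv : ℤ × ℤ ≃ ℤ × ℤ where
  toFun p := (p.2, p.1 - p.2)
  invFun q := (q.1 + q.2, q.1)
  left_inv p := by ext <;> simp
  right_inv q := by ext <;> simp

/-- **The weighted convolution family is summable**: `(k, l) ↦ a l b (k-l) σ^{-|k|}` is summable
on `ℤ × ℤ` (domination by the product family through the shear, by submultiplicativity). [folklore] -/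
theorem IsWSeq.summable_conv_family {σ : ℝ} {a b : ℤ → ℝ} (ha : IsWSeq σ a) (hb : IsWSeq σ b)
    (hσ : 0 < σ) (hσ1 : σ ≤ 1) :
    Summable fun p : ℤ × ℤ => a p.2 * b (p.1 - p.2) * gw σ p.1 := by
  have hF := (Equiv.summable_iff shearEquiv).2 (ha.summable_prod hb hσ.le) |>.congr
    (fun p => rfl)
  refine Summable.of_nonneg_of_le (fun p => mul_nonneg (mul_nonneg (ha.nonneg _) (hb.nonneg _))
    (gw_nonneg hσ.le _)) (fun p => ?_) hF
  simp only [Function.comp_apply, shearEquiv, Equiv.coe_fn_mk]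
  have hw : gw σ p.1 ≤ gw σ p.2 * gw σ (p.1 - p.2) := by
    have := gw_add_le hσ hσ1 p.2 (p.1 - p.2)
    rwa [add_sub_cancel] at this
  calc a p.2 * b (p.1 - p.2) * gw σ p.1 ≤ a p.2 * b (p.1 - p.2) * (gw σ p.2 * gw σ (p.1 - p.2)) :=
        mul_le_mul_of_nonneg_left hw (mul_nonneg (ha.nonneg _) (hb.nonneg _))
    _ = a p.2 * gw σ p.2 * (b (p.1 - p.2) * gw σ (p.1 - p.2)) := by ring

/-- Each fibre of the convolution is summable: `l ↦ a l b (k - l)`. [folklore] -/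
theorem IsWSeq.summable_conv_fibre {σ : ℝ} {a b : ℤ → ℝ} (ha : IsWSeq σ a) (hb : IsWSeq σ b)
    (hσ : 0 < σ) (hσ1 : σ ≤ 1) (k : ℤ) : Summable fun l => a l * b (k - l) := by
  have h := (ha.summable_conv_family hb hσ hσ1).prod_factor k
  have h' : Summable fun l => a l * b (k - l) * gw σ k := h
  have := h'.mul_right (gw σ k)⁻¹
  refine this.congr fun l => ?_
  field_simp [(gw_pos hσ k).ne']

/-- **Convolution preserves weighted sequences.** [folklore] -/
theorem IsWSeq.rconv {σ : ℝ} {a b : ℤ → ℝ} (ha : IsWSeq σ a) (hb : IsWSeq σ b) (hσ : 0 < σ)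
    (hσ1 : σ ≤ 1) : IsWSeq σ (Toeplitz.rconv a b) := by
  refine ⟨fun k => tsum_nonneg fun l => mul_nonneg (ha.nonneg l) (hb.nonneg _), ?_⟩
  have h := (ha.summable_conv_family hb hσ hσ1).prod
  refine h.congr fun k => ?_
  change ∑' l, a l * b (k - l) * gw σ k = Toeplitz.rconv a b k * gw σ k
  rw [Toeplitz.rconv, ← tsum_mul_right]

/-- **Submultiplicativity of the weighted norm under convolution**: `‖a ⋆ b‖ ≤ ‖a‖ ‖b‖`. [folklore] -/
theorem wnorm_rconv_le {σ : ℝ} {a b : ℤ → ℝ} (ha : IsWSeq σ a) (hb : IsWSeq σ b) (hσ : 0 < σ)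
    (hσ1 : σ ≤ 1) : wnorm σ (rconv a b) ≤ wnorm σ a * wnorm σ b := by
  have hfam := ha.summable_conv_family hb hσ hσ1
  have hprod := ha.summable_prod hb hσ.le
  -- `wnorm (a ⋆ b) = ∑_{(k,l)} a l b (k-l) gw k`
  have h1 : wnorm σ (rconv a b) = ∑' p : ℤ × ℤ, a p.2 * b (p.1 - p.2) * gw σ p.1 := by
    rw [wnorm, hfam.tsum_prod]
    refine tsum_congr fun k => ?_
    rw [rconv, ← tsum_mul_right]
  -- `‖a‖ ‖b‖ = ∑_{(l,m)} (a l gw l)(b m gw m)`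
  have h2 : wnorm σ a * wnorm σ b = ∑' p : ℤ × ℤ, (a p.1 * gw σ p.1) * (b p.2 * gw σ p.2) := by
    rw [wnorm, wnorm]
    exact ha.summable.tsum_mul_tsum hb.summable hprod
  rw [h1, h2, ← (Equiv.tsum_eq shearEquiv (fun q : ℤ × ℤ => (a q.1 * gw σ q.1) * (b q.2 * gw σ q.2)))]
  refine hfam.tsum_le_tsum (fun p => ?_) ((Equiv.summable_iff shearEquiv).2 hprod)
  simp only [shearEquiv, Equiv.coe_fn_mk]
  have hw : gw σ p.1 ≤ gw σ p.2 * gw σ (p.1 - p.2) := by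
    have := gw_add_le hσ hσ1 p.2 (p.1 - p.2)
    rwa [add_sub_cancel] at this
  calc a p.2 * b (p.1 - p.2) * gw σ p.1 ≤ a p.2 * b (p.1 - p.2) * (gw σ p.2 * gw σ (p.1 - p.2)) :=
        mul_le_mul_of_nonneg_left hw (mul_nonneg (ha.nonneg _) (hb.nonneg _))
    _ = a p.2 * gw σ p.2 * (b (p.1 - p.2) * gw σ (p.1 - p.2)) := by ring

/-! ### Dominated matrices -/

/-- **Domination by a Toeplitz majorant plus a corner majorant**:
`‖A i j‖ ≤ a (i - j) + C σ^{i+j}`. [folklore] -/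
def IsDom (σ : ℝ) (a : ℤ → ℝ) (C : ℝ) (A : Matrix ℕ ℕ ℂ) : Prop :=
  ∀ i j : ℕ, ‖A i j‖ ≤ a ((i : ℤ) - j) + C * σ ^ (i + j)

namespace IsDom

variable {σ : ℝ} {a b : ℤ → ℝ} {C D : ℝ} {A B : Matrix ℕ ℕ ℂ}

/-- A corner kernel is dominated (zero Toeplitz part). [folklore] -/
theorem of_isCorner (hK : IsCorner σ C A) : IsDom σ 0 C A := fun i j => by
  simpa using hK i j

/-- A Toeplitz-dominated matrix is dominated (zero corner part). [folklore] -/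
theorem of_toeplitz (h : ∀ i j : ℕ, ‖A i j‖ ≤ a ((i : ℤ) - j)) : IsDom σ a 0 A := fun i j => by
  simpa using h i j

/-- A dominated matrix with zero Toeplitz part is a corner kernel. [folklore] -/
theorem isCorner (h : IsDom σ 0 C A) : IsCorner σ C A := fun i j => by simpa using h i j

/-- Weakening the majorants. [folklore] -/
theorem mono (h : IsDom σ a C A) (hσ : 0 ≤ σ) (hab : ∀ k, a k ≤ b k) (hCD : C ≤ D) :
    IsDom σ b D A := fun i j =>
  (h i j).trans (add_le_add (hab _) (mul_le_mul_of_nonneg_right hCD (pow_nonneg hσ _)))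

/-- Sums. [folklore] -/
theorem add (hA : IsDom σ a C A) (hB : IsDom σ b D B) : IsDom σ (a + b) (C + D) (A + B) := fun i j =>
  calc ‖(A + B) i j‖ ≤ ‖A i j‖ + ‖B i j‖ := norm_add_le _ _
    _ ≤ a ((i : ℤ) - j) + C * σ ^ (i + j) + (b ((i : ℤ) - j) + D * σ ^ (i + j)) :=
        add_le_add (hA i j) (hB i j)
    _ = (a + b) ((i : ℤ) - j) + (C + D) * σ ^ (i + j) := by simp only [Pi.add_apply]; ring

/-- Negation. [folklore] -/
theorem neg (hA : IsDom σ a C A) : IsDom σ a C (-A) := fun i j => by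
  rw [Matrix.neg_apply, norm_neg]; exact hA i j

/-- Differences. [folklore] -/
theorem sub (hA : IsDom σ a C A) (hB : IsDom σ b D B) : IsDom σ (a + b) (C + D) (A - B) := by
  rw [sub_eq_add_neg]; exact hA.add hB.neg

/-- Scalar multiples. [folklore] -/
theorem smul (hA : IsDom σ a C A) (c : ℂ) : IsDom σ (‖c‖ • a) (‖c‖ * C) (c • A) := fun i j => by
  rw [Matrix.smul_apply, smul_eq_mul, norm_mul, Pi.smul_apply, smul_eq_mul, mul_assoc, ← mul_add]
  exact mul_le_mul_of_nonneg_left (hA i j) (norm_nonneg c)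

/-- The zero matrix. [folklore] -/
theorem zero (σ : ℝ) : IsDom σ 0 0 (0 : Matrix ℕ ℕ ℂ) := fun i j => by simp

/-- The identity matrix: Toeplitz majorant the indicator of `0`. [folklore] -/
theorem one (σ : ℝ) : IsDom σ (fun k => if k = 0 then 1 else 0) 0 (1 : Matrix ℕ ℕ ℂ) := by
  intro i j
  by_cases h : i = j
  · subst h; simp
  · have h' : ((i : ℤ) - j) ≠ 0 := by omega
    simp [h, h']

end IsDom

/-- The indicator of `0` is a weighted sequence of norm `1`. [folklore] -/
theorem isWSeq_indicator_zero (σ : ℝ) : IsWSeq σ (fun k : ℤ => if k = 0 then (1 : ℝ) else 0) := by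
  refine ⟨fun k => by split_ifs <;> norm_num, ?_⟩
  refine summable_of_ne_finset_zero (s := {0}) ?_
  intro k hk
  simp only [Finset.mem_singleton] at hk
  simp [hk]

/-- `wnorm` of the indicator of `0` is `1`. [folklore] -/
@[simp] theorem wnorm_indicator_zero (σ : ℝ) :
    wnorm σ (fun k : ℤ => if k = 0 then (1 : ℝ) else 0) = 1 := by
  rw [wnorm]
  have : (fun k : ℤ => (if k = 0 then (1 : ℝ) else 0) * gw σ k) = fun k => if k = 0 then 1 else 0 := by
    funext k; split_ifs with h <;> simp [h]
  rw [this, tsum_ite_eq]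

/-! ### The basic summability estimate -/

section Estimates

variable {σ : ℝ} {a b : ℤ → ℝ} {C D : ℝ}

/-- The Toeplitz majorant summed against the corner weight: `∑_m a (i - m) σ^m ≤ ‖a‖ σ^i`
(summability). [folklore] -/
theorem summable_majorant_mul_pow (ha : IsWSeq σ a) (hσ : 0 < σ) (hσ1 : σ ≤ 1) (i : ℕ) :
    Summable fun m : ℕ => a ((i : ℤ) - m) * σ ^ m := by
  have hinj : Function.Injective fun m : ℕ => (i : ℤ) - m := fun m m' h => by
    simpa using h
  have hs : Summable fun m : ℕ => a ((i : ℤ) - m) * gw σ ((i : ℤ) - m) :=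
    ha.summable.comp_injective hinj
  refine Summable.of_nonneg_of_le (fun m => mul_nonneg (ha.nonneg _) (pow_nonneg hσ.le _))
    (fun m => ?_) (hs.mul_left (σ ^ i))
  calc a ((i : ℤ) - m) * σ ^ m ≤ a ((i : ℤ) - m) * (σ ^ i * gw σ ((i : ℤ) - m)) :=
        mul_le_mul_of_nonneg_left (pow_le_pow_mul_gw hσ hσ1 m i) (ha.nonneg _)
    _ = σ ^ i * (a ((i : ℤ) - m) * gw σ ((i : ℤ) - m)) := by ring

/-- The Toeplitz majorant summed against the corner weight: `∑_m a (i - m) σ^m ≤ ‖a‖ σ^i`. [folklore] -/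
theorem tsum_majorant_mul_pow_le (ha : IsWSeq σ a) (hσ : 0 < σ) (hσ1 : σ ≤ 1) (i : ℕ) :
    ∑' m : ℕ, a ((i : ℤ) - m) * σ ^ m ≤ wnorm σ a * σ ^ i := by
  have hinj : Function.Injective fun m : ℕ => (i : ℤ) - m := fun m m' h => by
    simpa using h
  have hs : Summable fun m : ℕ => a ((i : ℤ) - m) * gw σ ((i : ℤ) - m) :=
    ha.summable.comp_injective hinj
  calc ∑' m : ℕ, a ((i : ℤ) - m) * σ ^ m
      ≤ ∑' m : ℕ, σ ^ i * (a ((i : ℤ) - m) * gw σ ((i : ℤ) - m)) := by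
        refine (summable_majorant_mul_pow ha hσ hσ1 i).tsum_le_tsum (fun m => ?_) (hs.mul_left _)
        calc a ((i : ℤ) - m) * σ ^ m ≤ a ((i : ℤ) - m) * (σ ^ i * gw σ ((i : ℤ) - m)) :=
              mul_le_mul_of_nonneg_left (pow_le_pow_mul_gw hσ hσ1 m i) (ha.nonneg _)
          _ = σ ^ i * (a ((i : ℤ) - m) * gw σ ((i : ℤ) - m)) := by ring
    _ = σ ^ i * ∑' m : ℕ, a ((i : ℤ) - m) * gw σ ((i : ℤ) - m) := tsum_mul_left
    _ ≤ σ ^ i * wnorm σ a := by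
        refine mul_le_mul_of_nonneg_left ?_ (pow_nonneg hσ.le _)
        exact tsum_comp_le_tsum_of_inj ha.summable (fun k => mul_nonneg (ha.nonneg k)
          (gw_nonneg hσ.le k)) hinj
    _ = wnorm σ a * σ ^ i := mul_comm _ _

/-- The column version: `∑_m σ^m a (m - j) ≤ ‖a‖ σ^j` (summability). [folklore] -/
theorem summable_pow_mul_majorant (ha : IsWSeq σ a) (hσ : 0 < σ) (hσ1 : σ ≤ 1) (j : ℕ) :
    Summable fun m : ℕ => σ ^ m * a ((m : ℤ) - j) := by
  have hinj : Function.Injective fun m : ℕ => (m : ℤ) - j := fun m m' h => by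
    simpa using h
  have hs : Summable fun m : ℕ => a ((m : ℤ) - j) * gw σ ((m : ℤ) - j) :=
    ha.summable.comp_injective hinj
  refine Summable.of_nonneg_of_le (fun m => mul_nonneg (pow_nonneg hσ.le _) (ha.nonneg _))
    (fun m => ?_) (hs.mul_left (σ ^ j))
  have hw : σ ^ m ≤ σ ^ j * gw σ ((m : ℤ) - j) := by
    have := pow_le_pow_mul_gw hσ hσ1 m j
    rwa [← gw_neg, neg_sub] at this
  calc σ ^ m * a ((m : ℤ) - j) ≤ σ ^ j * gw σ ((m : ℤ) - j) * a ((m : ℤ) - j) :=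
        mul_le_mul_of_nonneg_right hw (ha.nonneg _)
    _ = σ ^ j * (a ((m : ℤ) - j) * gw σ ((m : ℤ) - j)) := by ring

/-- The column version: `∑_m σ^m a (m - j) ≤ ‖a‖ σ^j`. [folklore] -/
theorem tsum_pow_mul_majorant_le (ha : IsWSeq σ a) (hσ : 0 < σ) (hσ1 : σ ≤ 1) (j : ℕ) :
    ∑' m : ℕ, σ ^ m * a ((m : ℤ) - j) ≤ wnorm σ a * σ ^ j := by
  have hinj : Function.Injective fun m : ℕ => (m : ℤ) - j := fun m m' h => by
    simpa using h
  have hs : Summable fun m : ℕ => a ((m : ℤ) - j) * gw σ ((m : ℤ) - j) :=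
    ha.summable.comp_injective hinj
  calc ∑' m : ℕ, σ ^ m * a ((m : ℤ) - j)
      ≤ ∑' m : ℕ, σ ^ j * (a ((m : ℤ) - j) * gw σ ((m : ℤ) - j)) := by
        refine (summable_pow_mul_majorant ha hσ hσ1 j).tsum_le_tsum (fun m => ?_) (hs.mul_left _)
        have hw : σ ^ m ≤ σ ^ j * gw σ ((m : ℤ) - j) := by
          have := pow_le_pow_mul_gw hσ hσ1 m j
          rwa [← gw_neg, neg_sub] at this
        calc σ ^ m * a ((m : ℤ) - j) ≤ σ ^ j * gw σ ((m : ℤ) - j) * a ((m : ℤ) - j) :=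
              mul_le_mul_of_nonneg_right hw (ha.nonneg _)
          _ = σ ^ j * (a ((m : ℤ) - j) * gw σ ((m : ℤ) - j)) := by ring
    _ = σ ^ j * ∑' m : ℕ, a ((m : ℤ) - j) * gw σ ((m : ℤ) - j) := tsum_mul_left
    _ ≤ σ ^ j * wnorm σ a := by
        refine mul_le_mul_of_nonneg_left ?_ (pow_nonneg hσ.le _)
        exact tsum_comp_le_tsum_of_inj ha.summable (fun k => mul_nonneg (ha.nonneg k)
          (gw_nonneg hσ.le k)) hinj
    _ = wnorm σ a * σ ^ j := mul_comm _ _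

/-- The Toeplitz–Toeplitz part: `m ↦ a (i - m) b (m - j)` is summable, with sum at most
`(a ⋆ b)(i - j)`. [folklore] -/
theorem summable_majorant_mul_majorant (ha : IsWSeq σ a) (hb : IsWSeq σ b) (hσ : 0 < σ)
    (hσ1 : σ ≤ 1) (i j : ℕ) : Summable fun m : ℕ => a ((i : ℤ) - m) * b ((m : ℤ) - j) := by
  have hinj : Function.Injective fun m : ℕ => (i : ℤ) - m := fun m m' h => by simpa using h
  have h := (ha.summable_conv_fibre hb hσ hσ1 ((i : ℤ) - j)).comp_injective hinj
  refine h.congr fun m => ?_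
  simp only [Function.comp_apply]
  congr 2
  ring

/-- The Toeplitz–Toeplitz part is bounded by the convolution of the majorants. [folklore] -/
theorem tsum_majorant_mul_majorant_le (ha : IsWSeq σ a) (hb : IsWSeq σ b) (hσ : 0 < σ)
    (hσ1 : σ ≤ 1) (i j : ℕ) :
    ∑' m : ℕ, a ((i : ℤ) - m) * b ((m : ℤ) - j) ≤ rconv a b ((i : ℤ) - j) := by
  have hinj : Function.Injective fun m : ℕ => (i : ℤ) - m := fun m m' h => by simpa using h
  have hfib := ha.summable_conv_fibre hb hσ hσ1 ((i : ℤ) - j)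
  have h := tsum_comp_le_tsum_of_inj hfib (fun l => mul_nonneg (ha.nonneg l) (hb.nonneg _)) hinj
  rw [rconv]
  refine le_of_eq_of_le ?_ h
  refine tsum_congr fun m => ?_
  simp only [Function.comp_apply]
  congr 2
  ring

/-- **The basic estimate**: for dominated `A`, `B` the series `∑_m ‖A i m‖ ‖B m j‖` is summable. [folklore] -/
theorem IsDom.summable_norm_mul {A B : Matrix ℕ ℕ ℂ} (hA : IsDom σ a C A) (hB : IsDom σ b D B)
    (ha : IsWSeq σ a) (hb : IsWSeq σ b) (hσ : 0 < σ) (hσ1 : σ < 1)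
    (i j : ℕ) : Summable fun m : ℕ => ‖A i m * B m j‖ := by
  have hσ2 : σ ^ 2 < 1 := pow_lt_one₀ hσ.le hσ1 two_ne_zero
  have hgeo := summable_geometric_of_lt_one (pow_nonneg hσ.le 2) hσ2
  -- the four-term majorant
  have hmaj : Summable fun m : ℕ => (a ((i : ℤ) - m) + C * σ ^ (i + m)) *
      (b ((m : ℤ) - j) + D * σ ^ (m + j)) := by
    have h1 := summable_majorant_mul_majorant ha hb hσ hσ1.le i j
    have h2 := (summable_majorant_mul_pow ha hσ hσ1.le i).mul_left (D * σ ^ j)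
    have h3 := (summable_pow_mul_majorant hb hσ hσ1.le j).mul_left (C * σ ^ i)
    have h4 := hgeo.mul_left (C * D * σ ^ (i + j))
    refine (((h1.add h2).add h3).add h4).congr fun m => ?_
    ring
  refine Summable.of_nonneg_of_le (fun m => norm_nonneg _) (fun m => ?_) hmaj
  rw [norm_mul]
  exact mul_le_mul (hA i m) (hB m j) (norm_nonneg _)
    (le_trans (norm_nonneg _) (hA i m))

/-- The defining series of a product of dominated matrices is summable. [folklore] -/
theorem IsDom.summable_mul {A B : Matrix ℕ ℕ ℂ} (hA : IsDom σ a C A) (hB : IsDom σ b D B)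
    (ha : IsWSeq σ a) (hb : IsWSeq σ b) (hσ : 0 < σ) (hσ1 : σ < 1)
    (i j : ℕ) : Summable fun m : ℕ => A i m * B m j :=
  (hA.summable_norm_mul hB ha hb hσ hσ1 i j).of_norm

/-- **The product estimate**: `∑_m ‖A i m‖ ‖B m j‖ ≤ (a ⋆ b)(i - j) + (D ‖a‖ + C ‖b‖ + C D/(1-σ²)) σ^{i+j}`. [folklore] -/
theorem IsDom.tsum_norm_mul_le {A B : Matrix ℕ ℕ ℂ} (hA : IsDom σ a C A) (hB : IsDom σ b D B)
    (ha : IsWSeq σ a) (hb : IsWSeq σ b) (hC : 0 ≤ C) (hD : 0 ≤ D) (hσ : 0 < σ) (hσ1 : σ < 1)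
    (i j : ℕ) :
    ∑' m : ℕ, ‖A i m * B m j‖ ≤ rconv a b ((i : ℤ) - j) +
      (D * wnorm σ a + C * wnorm σ b + C * D / (1 - σ ^ 2)) * σ ^ (i + j) := by
  have hσ2 : σ ^ 2 < 1 := pow_lt_one₀ hσ.le hσ1 two_ne_zero
  have hgeo := summable_geometric_of_lt_one (pow_nonneg hσ.le 2) hσ2
  have h1 := summable_majorant_mul_majorant ha hb hσ hσ1.le i j
  have h2 := (summable_majorant_mul_pow ha hσ hσ1.le i).mul_left (D * σ ^ j)
  have h3 := (summable_pow_mul_majorant hb hσ hσ1.le j).mul_left (C * σ ^ i)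
  have h4 := hgeo.mul_left (C * D * σ ^ (i + j))
  have hmaj : Summable fun m : ℕ => (a ((i : ℤ) - m) + C * σ ^ (i + m)) *
      (b ((m : ℤ) - j) + D * σ ^ (m + j)) := by
    refine (((h1.add h2).add h3).add h4).congr fun m => ?_
    ring
  calc ∑' m : ℕ, ‖A i m * B m j‖
      ≤ ∑' m : ℕ, (a ((i : ℤ) - m) + C * σ ^ (i + m)) * (b ((m : ℤ) - j) + D * σ ^ (m + j)) := by
        refine (hA.summable_norm_mul hB ha hb hσ hσ1 i j).tsum_le_tsum (fun m => ?_) hmaj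
        rw [norm_mul]
        exact mul_le_mul (hA i m) (hB m j) (norm_nonneg _) (le_trans (norm_nonneg _) (hA i m))
    _ = ∑' m : ℕ, (a ((i : ℤ) - m) * b ((m : ℤ) - j) + D * σ ^ j * (a ((i : ℤ) - m) * σ ^ m) +
          C * σ ^ i * (σ ^ m * b ((m : ℤ) - j)) + C * D * σ ^ (i + j) * (σ ^ 2) ^ m) := by
        refine tsum_congr fun m => ?_
        ring
    _ = (∑' m : ℕ, a ((i : ℤ) - m) * b ((m : ℤ) - j)) + D * σ ^ j * ∑' m : ℕ, a ((i : ℤ) - m) * σ ^ m +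
          C * σ ^ i * ∑' m : ℕ, σ ^ m * b ((m : ℤ) - j) + C * D * σ ^ (i + j) * ∑' m : ℕ, (σ ^ 2) ^ m := by
        rw [((h1.add h2).add h3).tsum_add h4, (h1.add h2).tsum_add h3, h1.tsum_add h2,
          tsum_mul_left, tsum_mul_left, tsum_mul_left]
    _ ≤ rconv a b ((i : ℤ) - j) + D * σ ^ j * (wnorm σ a * σ ^ i) + C * σ ^ i * (wnorm σ b * σ ^ j) +
          C * D * σ ^ (i + j) * (1 - σ ^ 2)⁻¹ := by
        rw [tsum_geometric_of_lt_one (pow_nonneg hσ.le 2) hσ2]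
        refine add_le_add (add_le_add (add_le_add (tsum_majorant_mul_majorant_le ha hb hσ hσ1.le i j)
          ?_) ?_) le_rfl
        · exact mul_le_mul_of_nonneg_left (tsum_majorant_mul_pow_le ha hσ hσ1.le i)
            (mul_nonneg hD (pow_nonneg hσ.le _))
        · exact mul_le_mul_of_nonneg_left (tsum_pow_mul_majorant_le hb hσ hσ1.le j)
            (mul_nonneg hC (pow_nonneg hσ.le _))
    _ = rconv a b ((i : ℤ) - j) + (D * wnorm σ a + C * wnorm σ b + C * D / (1 - σ ^ 2)) * σ ^ (i + j) := by
        rw [pow_add]; ring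

/-- **Products of dominated matrices are dominated**: Toeplitz majorant `a ⋆ b`, corner constant
`D ‖a‖ + C ‖b‖ + C D / (1 - σ²)`. [folklore] -/
theorem IsDom.imul {A B : Matrix ℕ ℕ ℂ} (hA : IsDom σ a C A) (hB : IsDom σ b D B)
    (ha : IsWSeq σ a) (hb : IsWSeq σ b) (hC : 0 ≤ C) (hD : 0 ≤ D) (hσ : 0 < σ) (hσ1 : σ < 1) :
    IsDom σ (rconv a b) (D * wnorm σ a + C * wnorm σ b + C * D / (1 - σ ^ 2)) (imul A B) := by
  intro i j
  rw [imul_apply]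
  exact (norm_tsum_le_tsum_norm (hA.summable_norm_mul hB ha hb hσ hσ1 i j)).trans
    (hA.tsum_norm_mul_le hB ha hb hC hD hσ hσ1 i j)

/-- The corner constant of a product is nonnegative. [folklore] -/
theorem imul_const_nonneg (ha : IsWSeq σ a) (hb : IsWSeq σ b) (hC : 0 ≤ C) (hD : 0 ≤ D)
    (hσ : 0 ≤ σ) (hσ1 : σ < 1) : 0 ≤ D * wnorm σ a + C * wnorm σ b + C * D / (1 - σ ^ 2) := by
  have : 0 < 1 - σ ^ 2 := by nlinarith [pow_lt_one₀ hσ hσ1 two_ne_zero, pow_nonneg hσ 2]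
  exact add_nonneg (add_nonneg (mul_nonneg hD (wnorm_nonneg ha hσ)) (mul_nonneg hC (wnorm_nonneg hb hσ)))
    (div_nonneg (mul_nonneg hC hD) this.le)

/-- **Dominated matrices are row-dominated** (constant `‖a‖ + C/(1-σ²)`). [folklore] -/
theorem IsDom.isRowDom {A : Matrix ℕ ℕ ℂ} (hA : IsDom σ a C A) (ha : IsWSeq σ a)
    (hσ : 0 < σ) (hσ1 : σ < 1) : IsRowDom σ (wnorm σ a + C / (1 - σ ^ 2)) A := by
  intro i
  have hσ2 : σ ^ 2 < 1 := pow_lt_one₀ hσ.le hσ1 two_ne_zero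
  have hgeo := summable_geometric_of_lt_one (pow_nonneg hσ.le 2) hσ2
  have hle : ∀ m : ℕ, ‖A i m‖ * σ ^ m ≤ a ((i : ℤ) - m) * σ ^ m + C * σ ^ i * (σ ^ 2) ^ m := fun m =>
    calc ‖A i m‖ * σ ^ m ≤ (a ((i : ℤ) - m) + C * σ ^ (i + m)) * σ ^ m :=
          mul_le_mul_of_nonneg_right (hA i m) (pow_nonneg hσ.le _)
      _ = a ((i : ℤ) - m) * σ ^ m + C * σ ^ i * (σ ^ 2) ^ m := by ring
  have hmaj := (summable_majorant_mul_pow ha hσ hσ1.le i).add (hgeo.mul_left (C * σ ^ i))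
  have hs : Summable fun m : ℕ => ‖A i m‖ * σ ^ m :=
    Summable.of_nonneg_of_le (fun m => mul_nonneg (norm_nonneg _) (pow_nonneg hσ.le _)) hle hmaj
  refine ⟨hs, ?_⟩
  calc ∑' m : ℕ, ‖A i m‖ * σ ^ m ≤ ∑' m : ℕ, (a ((i : ℤ) - m) * σ ^ m + C * σ ^ i * (σ ^ 2) ^ m) :=
        hs.tsum_le_tsum hle hmaj
    _ = (∑' m : ℕ, a ((i : ℤ) - m) * σ ^ m) + C * σ ^ i * ∑' m : ℕ, (σ ^ 2) ^ m := by
        rw [(summable_majorant_mul_pow ha hσ hσ1.le i).tsum_add (hgeo.mul_left _), tsum_mul_left]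
    _ ≤ wnorm σ a * σ ^ i + C * σ ^ i * (1 - σ ^ 2)⁻¹ := by
        rw [tsum_geometric_of_lt_one (pow_nonneg hσ.le 2) hσ2]
        exact add_le_add (tsum_majorant_mul_pow_le ha hσ hσ1.le i) le_rfl
    _ = (wnorm σ a + C / (1 - σ ^ 2)) * σ ^ i := by ring

/-- **Dominated matrices are column-dominated** (constant `‖a‖ + C/(1-σ²)`). [folklore] -/
theorem IsDom.isColDom {A : Matrix ℕ ℕ ℂ} (hA : IsDom σ a C A) (ha : IsWSeq σ a)
    (hσ : 0 < σ) (hσ1 : σ < 1) : IsColDom σ (wnorm σ a + C / (1 - σ ^ 2)) A := by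
  intro j
  have hσ2 : σ ^ 2 < 1 := pow_lt_one₀ hσ.le hσ1 two_ne_zero
  have hgeo := summable_geometric_of_lt_one (pow_nonneg hσ.le 2) hσ2
  have hle : ∀ m : ℕ, σ ^ m * ‖A m j‖ ≤ σ ^ m * a ((m : ℤ) - j) + C * σ ^ j * (σ ^ 2) ^ m := fun m =>
    calc σ ^ m * ‖A m j‖ ≤ σ ^ m * (a ((m : ℤ) - j) + C * σ ^ (m + j)) :=
          mul_le_mul_of_nonneg_left (hA m j) (pow_nonneg hσ.le _)
      _ = σ ^ m * a ((m : ℤ) - j) + C * σ ^ j * (σ ^ 2) ^ m := by ring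
  have hmaj := (summable_pow_mul_majorant ha hσ hσ1.le j).add (hgeo.mul_left (C * σ ^ j))
  have hs : Summable fun m : ℕ => σ ^ m * ‖A m j‖ :=
    Summable.of_nonneg_of_le (fun m => mul_nonneg (pow_nonneg hσ.le _) (norm_nonneg _)) hle hmaj
  refine ⟨hs, ?_⟩
  calc ∑' m : ℕ, σ ^ m * ‖A m j‖ ≤ ∑' m : ℕ, (σ ^ m * a ((m : ℤ) - j) + C * σ ^ j * (σ ^ 2) ^ m) :=
        hs.tsum_le_tsum hle hmaj
    _ = (∑' m : ℕ, σ ^ m * a ((m : ℤ) - j)) + C * σ ^ j * ∑' m : ℕ, (σ ^ 2) ^ m := by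
        rw [(summable_pow_mul_majorant ha hσ hσ1.le j).tsum_add (hgeo.mul_left _), tsum_mul_left]
    _ ≤ wnorm σ a * σ ^ j + C * σ ^ j * (1 - σ ^ 2)⁻¹ := by
        rw [tsum_geometric_of_lt_one (pow_nonneg hσ.le 2) hσ2]
        exact add_le_add (tsum_pow_mul_majorant_le ha hσ hσ1.le j) le_rfl
    _ = (wnorm σ a + C / (1 - σ ^ 2)) * σ ^ j := by ring

end Estimates

/-! ### Associativity and distributivity -/

section Algebra

variable {σ : ℝ} {a b c : ℤ → ℝ} {C D E : ℝ} {A B X : Matrix ℕ ℕ ℂ}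

/-- **Associativity of the product of dominated matrices** (Fubini: the triple series is
absolutely convergent). [folklore] -/
theorem imul_assoc (hA : IsDom σ a C A) (hB : IsDom σ b D B) (hX : IsDom σ c E X)
    (ha : IsWSeq σ a) (hb : IsWSeq σ b) (hc : IsWSeq σ c) (hD : 0 ≤ D) (hE : 0 ≤ E)
    (hσ : 0 < σ) (hσ1 : σ < 1) : imul (imul A B) X = imul A (imul B X) := by
  ext i j
  -- the double family `(m, l) ↦ A i m * B m l * X l j` is summable
  have hBX := hB.imul hX hb hc hD hE hσ hσ1
  have hbc := hb.rconv hc hσ hσ1.le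
  have hconst := imul_const_nonneg hb hc hD hE hσ.le hσ1
  set F : ℕ × ℕ → ℂ := fun p => A i p.1 * B p.1 p.2 * X p.2 j with hF
  have hFs : Summable F := by
    refine Summable.of_norm ?_
    rw [summable_prod_of_nonneg (fun p => norm_nonneg _)]
    constructor
    · intro m
      have := (hB.summable_norm_mul hX hb hc hσ hσ1 m j).mul_left ‖A i m‖
      refine this.congr fun l => ?_
      simp only [hF, norm_mul]; ring
    · -- `m ↦ ‖A i m‖ ∑_l ‖B m l X l j‖ ≤ ‖A i m‖ · (majorant of B X at (m, j))`
      have hmaj : Summable fun m : ℕ => ‖A i m‖ * (rconv b c ((m : ℤ) - j) +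
          (E * wnorm σ b + D * wnorm σ c + D * E / (1 - σ ^ 2)) * σ ^ (m + j)) := by
        -- this is the summability of `‖A i m‖ · (dominating entry)`: compare with the four-term bound
        have h := hA.summable_norm_mul (B := fun m j => ((rconv b c ((m : ℤ) - j) +
            (E * wnorm σ b + D * wnorm σ c + D * E / (1 - σ ^ 2)) * σ ^ (m + j) : ℝ) : ℂ))
          (b := rconv b c) (D := E * wnorm σ b + D * wnorm σ c + D * E / (1 - σ ^ 2))
          (fun m j => by
            rw [Complex.norm_real, Real.norm_of_nonneg (add_nonneg (hbc.nonneg _)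
              (mul_nonneg hconst (pow_nonneg hσ.le _)))])
          ha hbc hσ hσ1 i j
        refine h.congr fun m => ?_
        rw [norm_mul, Complex.norm_real, Real.norm_of_nonneg (add_nonneg (hbc.nonneg _)
          (mul_nonneg hconst (pow_nonneg hσ.le _)))]
      refine Summable.of_nonneg_of_le (fun m => tsum_nonneg fun l => norm_nonneg _) (fun m => ?_) hmaj
      have hs := hB.summable_norm_mul hX hb hc hσ hσ1 m j
      calc ∑' l, ‖F (m, l)‖ = ∑' l, ‖A i m‖ * ‖B m l * X l j‖ := by
            refine tsum_congr fun l => ?_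
            simp only [hF, norm_mul]; ring
        _ = ‖A i m‖ * ∑' l, ‖B m l * X l j‖ := tsum_mul_left
        _ ≤ ‖A i m‖ * (rconv b c ((m : ℤ) - j) +
            (E * wnorm σ b + D * wnorm σ c + D * E / (1 - σ ^ 2)) * σ ^ (m + j)) :=
            mul_le_mul_of_nonneg_left (hB.tsum_norm_mul_le hX hb hc hD hE hσ hσ1 m j) (norm_nonneg _)
  -- rewrite both sides as iterated sums of `F`
  have hL : imul (imul A B) X i j = ∑' l, ∑' m, F (m, l) := by
    rw [imul_apply]
    refine tsum_congr fun l => ?_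
    rw [imul_apply, ← tsum_mul_right]
  have hR : imul A (imul B X) i j = ∑' m, ∑' l, F (m, l) := by
    rw [imul_apply]
    refine tsum_congr fun m => ?_
    rw [imul_apply, ← tsum_mul_left]
    refine tsum_congr fun l => ?_
    simp only [hF]; ring
  rw [hL, hR]
  exact Summable.tsum_comm (f := fun m l => F (m, l)) hFs

/-- Left distributivity for dominated matrices. [folklore] -/
theorem IsDom.imul_add (hA : IsDom σ a C A) (hB : IsDom σ b D B) (hX : IsDom σ c E X)
    (ha : IsWSeq σ a) (hb : IsWSeq σ b) (hc : IsWSeq σ c)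
    (hσ : 0 < σ) (hσ1 : σ < 1) : Toeplitz.imul A (B + X) = Toeplitz.imul A B + Toeplitz.imul A X :=
  Toeplitz.imul_add (fun i j => hA.summable_mul hB ha hb hσ hσ1 i j)
    (fun i j => hA.summable_mul hX ha hc hσ hσ1 i j)

/-- Right distributivity for dominated matrices. [folklore] -/
theorem IsDom.add_imul (hA : IsDom σ a C A) (hB : IsDom σ b D B) (hX : IsDom σ c E X)
    (ha : IsWSeq σ a) (hb : IsWSeq σ b) (hc : IsWSeq σ c)
    (hσ : 0 < σ) (hσ1 : σ < 1) : Toeplitz.imul (A + B) X = Toeplitz.imul A X + Toeplitz.imul B X :=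
  Toeplitz.add_imul (fun i j => hA.summable_mul hX ha hc hσ hσ1 i j)
    (fun i j => hB.summable_mul hX hb hc hσ hσ1 i j)

end Algebra

/-! ### The ring of dominated matrices -/

/-- **The Wiener–corner algebra** at rate `σ`: matrices dominated by some weighted Toeplitz
majorant plus some corner majorant. [folklore] -/
def DomMat (σ : ℝ) : Type :=
  {A : Matrix ℕ ℕ ℂ // ∃ (a : ℤ → ℝ) (C : ℝ), IsWSeq σ a ∧ 0 ≤ C ∧ IsDom σ a C A}

namespace DomMat

variable {σ : ℝ}

/-- The underlying matrix. [folklore] -/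
instance : CoeOut (DomMat σ) (Matrix ℕ ℕ ℂ) := ⟨Subtype.val⟩

/-- Two dominated matrices are equal iff their matrices are. [folklore] -/
@[ext] theorem ext {A B : DomMat σ} (h : (A : Matrix ℕ ℕ ℂ) = B) : A = B := Subtype.ext h

/-- Build a dominated matrix from a domination certificate. [folklore] -/
def mk' (A : Matrix ℕ ℕ ℂ) {a : ℤ → ℝ} {C : ℝ} (ha : IsWSeq σ a) (hC : 0 ≤ C) (hA : IsDom σ a C A) :
    DomMat σ := ⟨A, a, C, ha, hC, hA⟩

/-- The matrix of `mk'`. [folklore] -/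
@[simp] theorem coe_mk' (A : Matrix ℕ ℕ ℂ) {a : ℤ → ℝ} {C : ℝ} (ha : IsWSeq σ a) (hC : 0 ≤ C)
    (hA : IsDom σ a C A) : ((mk' A ha hC hA : DomMat σ) : Matrix ℕ ℕ ℂ) = A := rfl

/-- Zero. [folklore] -/
theorem zero_mem : ∃ (a : ℤ → ℝ) (C : ℝ), IsWSeq σ a ∧ 0 ≤ C ∧ IsDom σ a C (0 : Matrix ℕ ℕ ℂ) :=
  ⟨0, 0, IsWSeq.zero σ, le_rfl, IsDom.zero σ⟩

/-- One. [folklore] -/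
theorem one_mem : ∃ (a : ℤ → ℝ) (C : ℝ), IsWSeq σ a ∧ 0 ≤ C ∧ IsDom σ a C (1 : Matrix ℕ ℕ ℂ) :=
  ⟨_, 0, isWSeq_indicator_zero σ, le_rfl, IsDom.one σ⟩

/-- Closure under addition. [folklore] -/
theorem add_mem {A B : Matrix ℕ ℕ ℂ}
    (hA : ∃ (a : ℤ → ℝ) (C : ℝ), IsWSeq σ a ∧ 0 ≤ C ∧ IsDom σ a C A)
    (hB : ∃ (a : ℤ → ℝ) (C : ℝ), IsWSeq σ a ∧ 0 ≤ C ∧ IsDom σ a C B) :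
    ∃ (a : ℤ → ℝ) (C : ℝ), IsWSeq σ a ∧ 0 ≤ C ∧ IsDom σ a C (A + B) := by
  obtain ⟨a, C, ha, hC, hA⟩ := hA
  obtain ⟨b, D, hb, hD, hB⟩ := hB
  exact ⟨a + b, C + D, ha.add hb, add_nonneg hC hD, hA.add hB⟩

/-- Closure under negation. [folklore] -/
theorem neg_mem {A : Matrix ℕ ℕ ℂ}
    (hA : ∃ (a : ℤ → ℝ) (C : ℝ), IsWSeq σ a ∧ 0 ≤ C ∧ IsDom σ a C A) :
    ∃ (a : ℤ → ℝ) (C : ℝ), IsWSeq σ a ∧ 0 ≤ C ∧ IsDom σ a C (-A) := by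
  obtain ⟨a, C, ha, hC, hA⟩ := hA
  exact ⟨a, C, ha, hC, hA.neg⟩

/-- Closure under the product. [folklore] -/
theorem mul_mem [hσ : Fact (0 < σ)] [hσ1 : Fact (σ < 1)] {A B : Matrix ℕ ℕ ℂ}
    (hA : ∃ (a : ℤ → ℝ) (C : ℝ), IsWSeq σ a ∧ 0 ≤ C ∧ IsDom σ a C A)
    (hB : ∃ (a : ℤ → ℝ) (C : ℝ), IsWSeq σ a ∧ 0 ≤ C ∧ IsDom σ a C B) :
    ∃ (a : ℤ → ℝ) (C : ℝ), IsWSeq σ a ∧ 0 ≤ C ∧ IsDom σ a C (imul A B) := by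
  obtain ⟨a, C, ha, hC, hA⟩ := hA
  obtain ⟨b, D, hb, hD, hB⟩ := hB
  exact ⟨_, _, ha.rconv hb hσ.out hσ1.out.le, imul_const_nonneg ha hb hC hD hσ.out.le hσ1.out,
    hA.imul hB ha hb hC hD hσ.out hσ1.out⟩

/-- The zero dominated matrix. [folklore] -/
instance : Zero (DomMat σ) := ⟨⟨0, zero_mem⟩⟩
/-- The identity dominated matrix. [folklore] -/
instance : One (DomMat σ) := ⟨⟨1, one_mem⟩⟩
/-- Entrywise sum of dominated matrices. [folklore] -/
instance : Add (DomMat σ) := ⟨fun A B => ⟨A.1 + B.1, add_mem A.2 B.2⟩⟩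
/-- Entrywise negation of a dominated matrix. [folklore] -/
instance : Neg (DomMat σ) := ⟨fun A => ⟨-A.1, neg_mem A.2⟩⟩
/-- Entrywise difference of dominated matrices. [folklore] -/
instance : Sub (DomMat σ) := ⟨fun A B => ⟨A.1 + -B.1, add_mem A.2 (neg_mem B.2)⟩⟩
/-- The product `imul` of dominated matrices (`0 < σ < 1`). [folklore] -/
instance [Fact (0 < σ)] [Fact (σ < 1)] : Mul (DomMat σ) := ⟨fun A B => ⟨imul A.1 B.1, mul_mem A.2 B.2⟩⟩

/-- The matrix of `0`. [folklore] -/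
@[simp] theorem coe_zero : ((0 : DomMat σ) : Matrix ℕ ℕ ℂ) = 0 := rfl
/-- The matrix of `1`. [folklore] -/
@[simp] theorem coe_one : ((1 : DomMat σ) : Matrix ℕ ℕ ℂ) = 1 := rfl
/-- The matrix of a sum. [folklore] -/
@[simp] theorem coe_add (A B : DomMat σ) : ((A + B : DomMat σ) : Matrix ℕ ℕ ℂ) = A + B := rfl
/-- The matrix of a negation. [folklore] -/
@[simp] theorem coe_neg (A : DomMat σ) : ((-A : DomMat σ) : Matrix ℕ ℕ ℂ) = -A := rfl
/-- The matrix of a difference. [folklore] -/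
@[simp] theorem coe_sub (A B : DomMat σ) : ((A - B : DomMat σ) : Matrix ℕ ℕ ℂ) = A - B :=
  (sub_eq_add_neg (A : Matrix ℕ ℕ ℂ) B).symm ▸ rfl
/-- The matrix of a product is `imul`. [folklore] -/
@[simp] theorem coe_mul [Fact (0 < σ)] [Fact (σ < 1)] (A B : DomMat σ) : ((A * B : DomMat σ) : Matrix ℕ ℕ ℂ) = imul A B := rfl

/-- **The dominated matrices form a ring** under `imul`. [folklore] -/
instance instRing [hσ : Fact (0 < σ)] [hσ1 : Fact (σ < 1)] : Ring (DomMat σ) where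
  add_assoc A B C := ext (by simp [add_assoc])
  zero_add A := ext (by simp)
  add_zero A := ext (by simp)
  add_comm A B := ext (by simp [add_comm])
  neg_add_cancel A := ext (by simp)
  sub_eq_add_neg A B := ext rfl
  nsmul := nsmulRec
  zsmul := zsmulRec
  mul_assoc A B C := by
    obtain ⟨a, Ca, ha, hCa, hA⟩ := A.2
    obtain ⟨b, Cb, hb, hCb, hB⟩ := B.2
    obtain ⟨c, Cc, hc, hCc, hC⟩ := C.2
    exact ext (imul_assoc hA hB hC ha hb hc hCb hCc hσ.out hσ1.out)
  one_mul A := ext (one_imul _)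
  mul_one A := ext (imul_one _)
  zero_mul A := ext (zero_imul _)
  mul_zero A := ext (imul_zero _)
  left_distrib A B C := by
    obtain ⟨a, Ca, ha, hCa, hA⟩ := A.2
    obtain ⟨b, Cb, hb, hCb, hB⟩ := B.2
    obtain ⟨c, Cc, hc, hCc, hC⟩ := C.2
    exact ext (hA.imul_add hB hC ha hb hc hσ.out hσ1.out)
  right_distrib A B C := by
    obtain ⟨a, Ca, ha, hCa, hA⟩ := A.2
    obtain ⟨b, Cb, hb, hCb, hB⟩ := B.2
    obtain ⟨c, Cc, hc, hCc, hC⟩ := C.2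
    exact ext (hA.add_imul hB hC ha hb hc hσ.out hσ1.out)

/-- Every element has a domination certificate (restated for convenience). [folklore] -/
theorem exists_isDom (A : DomMat σ) :
    ∃ (a : ℤ → ℝ) (C : ℝ), IsWSeq σ a ∧ 0 ≤ C ∧ IsDom σ a C (A : Matrix ℕ ℕ ℂ) := A.2

end DomMat

end Literature.Analysis.Toeplitz
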